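import Summits.ValiantsHypothesis.ValiantsHypothesis.Theorems.LacunarySymmetroidMatrixDescartesCensusTropicalKLawBridges

/-!
# Route «KPlusLogSqLaw» — the WEAK lifting bridge (toward crux `Lifting`, stmt-ValiantsHypothesis-19772)

HONEST FRAMING.  Bookkeeping implications only, between statements that are all OPEN conjectures of the object-search
cell `pub-symmetroid` (route `KPlusLogSqLaw`, D-0041/D-0059); nothing here asserts `Lifting`, `TropicalB`,
`KPlusLogSqLaw`, `MatrixDescartes` or anything about `VP ≠ VNP`.

The route attacks Conjecture B (`KPlusLogSqLaw`: at most `2^{C (K + log₂² m)}` distinct real zeros for the determinant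
of every real symmetric lacunary pencil of format `(m, K)`) as TB ∧ LIFT, where LIFT = `TropicalLifting` allows the real
census to exceed the tropical census by a factor `2^{C K}`.  At FIXED `K` that factor is a constant, so LIFT as typed
demands that the real maximum and the tropical maximum have the same polynomial degree in `m` — the «`K = 4` fork»
of the cell (ONBOARD-val-sym §3.3: if `ζ(m,4) = Θ(m³)` while `T(m,4) = O(m²)`, LIFT as typed is false although B may
survive).  The repair in waiting is the WEAK lifting statement with slack `2^{C (K + log₂² m)}` instead of `2^{C K}`;
it still closes B together with TB.  This file records that bridge in the kernel, with the weak hypothesis SPELLED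
INLINE (no new named `Prop`):

* `weakLifting_of_tropicalLifting` — LIFT ⇒ weak LIFT;
* `kPlusLogSqLaw_of_weakLifting_of_tropKPlusLogSqLaw` — weak LIFT ∧ TB ⇒ B (constant `C + C' + 1`);
* `weakLifting_of_kPlusLogSqLaw` — B ⇒ weak LIFT (trivially, with no tropical input: B bounds the real row outright);
* `kPlusLogSqLaw_iff_trop_of_weakLifting` — given weak LIFT, B ⇔ TB (the converse is the tree's patchworking
  theorem `tropKPlusLogSqLaw_of_kPlusLogSqLaw`);
* `kPlusLogSqLaw_iff_weakLifting_and_trop` — B ⇔ (weak LIFT ∧ TB): the weak split loses nothing.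

So the weak form is EXACTLY as strong as the route needs: B holds iff TB holds and weak LIFT holds. [folklore]
-/

-- `Summit.ValiantsHypothesis.ValiantsHypothesis.…` repeats a component by the D-0017 layout
-- (single-conjunct summit), which the `dupNamespace` linter flags; the name is mandated.
set_option linter.dupNamespace false
set_option autoImplicit false

namespace Summit.ValiantsHypothesis.ValiantsHypothesis.Theorems.LacunarySymmetroidMatrixDescartes.TropicalCensus

open Summit.ValiantsHypothesis.ValiantsHypothesis.Theorems.LacunarySymmetroidMatrixDescartes

/-- **LIFT ⇒ weak LIFT**: the slack `2^{C K}` is at most `2^{C (K + log₂² m)}`. [folklore] -/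
theorem weakLifting_of_tropicalLifting (hL : TropicalLifting) :
    ∃ C : ℕ, ∀ m K n : ℕ, TropRootLawAt m K n →
      RealRootLawAt m K (2 ^ (C * (K + Nat.log 2 m ^ 2)) * (n + 1)) := by
  obtain ⟨C, hC⟩ := hL
  refine ⟨C, fun m K n hT => Census.realRootLawAt_mono ?_ (hC m K n hT)⟩
  exact Nat.mul_le_mul_right _ (Nat.pow_le_pow_right (by norm_num) (Nat.mul_le_mul_left _ (Nat.le_add_right _ _)))

/-- **weak LIFT ∧ TB ⇒ B** (`2^{C(K + L²)} · (2^{C'(K + L²)} + 1) ≤ 2^{(C + C' + 1)(K + L²)}` for `K ≥ 1`, `L = ⌊log₂ m⌋`;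
the `K = 0` corner is `realRootLawAt_zero`). [folklore] -/
theorem kPlusLogSqLaw_of_weakLifting_of_tropKPlusLogSqLaw
    (hL : ∃ C : ℕ, ∀ m K n : ℕ, TropRootLawAt m K n →
      RealRootLawAt m K (2 ^ (C * (K + Nat.log 2 m ^ 2)) * (n + 1)))
    (hT : TropKPlusLogSqLaw) : KPlusLogSqLaw := by
  obtain ⟨C, hC⟩ := hL
  obtain ⟨C', hC'⟩ := hT
  refine ⟨C + C' + 1, fun m K => ?_⟩
  rcases Nat.eq_zero_or_pos K with hK | hK
  · subst hK; exact realRootLawAt_zero m _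
  · have h := hC m K _ (hC' m K)
    apply Census.realRootLawAt_mono _ h
    have key : ∀ E : ℕ, 2 ^ E + 1 ≤ 2 ^ (E + 1) := fun E => by
      have := Nat.one_le_two_pow (n := E)
      rw [Nat.pow_succ]; omega
    have h2 : 2 ^ (C' * (K + Nat.log 2 m ^ 2)) + 1 ≤ 2 ^ (C' * (K + Nat.log 2 m ^ 2) + 1) := key _
    calc 2 ^ (C * (K + Nat.log 2 m ^ 2)) * (2 ^ (C' * (K + Nat.log 2 m ^ 2)) + 1)
        ≤ 2 ^ (C * (K + Nat.log 2 m ^ 2)) * 2 ^ (C' * (K + Nat.log 2 m ^ 2) + 1) := Nat.mul_le_mul_left _ h2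
      _ = 2 ^ (C * (K + Nat.log 2 m ^ 2) + (C' * (K + Nat.log 2 m ^ 2) + 1)) := by rw [← pow_add]
      _ ≤ 2 ^ ((C + C' + 1) * (K + Nat.log 2 m ^ 2)) := by
          apply Nat.pow_le_pow_right (by norm_num)
          nlinarith

/-- **B ⇒ weak LIFT**, with no tropical input: B bounds the real row by `2^{C(K+L²)} ≤ 2^{C(K+L²)}·(n+1)` outright.
(So weak LIFT, unlike TB, carries no information beyond B itself unless proved with a constant independent of B.) [folklore] -/
theorem weakLifting_of_kPlusLogSqLaw (h : KPlusLogSqLaw) :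
    ∃ C : ℕ, ∀ m K n : ℕ, TropRootLawAt m K n →
      RealRootLawAt m K (2 ^ (C * (K + Nat.log 2 m ^ 2)) * (n + 1)) := by
  obtain ⟨C, hC⟩ := h
  refine ⟨C, fun m K n _ => Census.realRootLawAt_mono ?_ (hC m K)⟩
  exact Nat.le_mul_of_pos_right _ (Nat.succ_pos n)

/-- **Given weak LIFT, B ⇔ TB** (`←`: the weak bridge; `→`: patchworking, `tropKPlusLogSqLaw_of_kPlusLogSqLaw`). [folklore] -/
theorem kPlusLogSqLaw_iff_trop_of_weakLifting
    (hL : ∃ C : ℕ, ∀ m K n : ℕ, TropRootLawAt m K n →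
      RealRootLawAt m K (2 ^ (C * (K + Nat.log 2 m ^ 2)) * (n + 1))) :
    KPlusLogSqLaw ↔ TropKPlusLogSqLaw :=
  ⟨tropKPlusLogSqLaw_of_kPlusLogSqLaw, kPlusLogSqLaw_of_weakLifting_of_tropKPlusLogSqLaw hL⟩

/-- **B ⇔ (weak LIFT ∧ TB)**: the weak split of Conjecture B is lossless. [folklore] -/
theorem kPlusLogSqLaw_iff_weakLifting_and_trop :
    KPlusLogSqLaw ↔
      ((∃ C : ℕ, ∀ m K n : ℕ, TropRootLawAt m K n →
        RealRootLawAt m K (2 ^ (C * (K + Nat.log 2 m ^ 2)) * (n + 1))) ∧ TropKPlusLogSqLaw) :=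
  ⟨fun h => ⟨weakLifting_of_kPlusLogSqLaw h, tropKPlusLogSqLaw_of_kPlusLogSqLaw h⟩,
    fun h => kPlusLogSqLaw_of_weakLifting_of_tropKPlusLogSqLaw h.1 h.2⟩

end Summit.ValiantsHypothesis.ValiantsHypothesis.Theorems.LacunarySymmetroidMatrixDescartes.TropicalCensus
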